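import Summits.QuantumAdvantage.QuantumAdvantage.Theorems.PerceptronDialLawsA
import Summits.QuantumAdvantage.QuantumAdvantage.Theorems.FlatDialReadout

/-! # PerceptronDialLawsB — part 2/4 (mechanical split for landing of `PerceptronDialLaws`; content verbatim; scopes re-opened with their variables) -/

set_option linter.dupNamespace false
noncomputable section

namespace Summit.QuantumAdvantage.QuantumAdvantage.Theorems.PerceptronDial
open Finset
open Literature.Computability.Complexity
open Literature.Computability.QuantumComplexity
open Literature.Computability.QuantumComplexity.BuzetChailloux (bxor zeroVec)
open Summit.QuantumAdvantage.QuantumAdvantage.Theses.AnfPresentation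
open Summit.QuantumAdvantage.QuantumAdvantage.Theorems.HintDial
open Summit.QuantumAdvantage.QuantumAdvantage.Theorems.HintDial.Automaton
open Summit.QuantumAdvantage.QuantumAdvantage.Theorems.HintDial (bit_xor bit_and bit_not bit_eq_ite bit_decide_odd bit_injective bit_mul_self bit_false eval_bit)
open CubicForm (bit)
open DerivativeWalsh (W)
open Summit.QuantumAdvantage.QuantumAdvantage.Theorems.PebbleDial (AnfIdx bitsFG bits)
variable {n k : ℕ}

section IPFace
variable (k)
variable {k}
variable (s t : Fin k → Bool) (c : Bool)

/-- ★★ [dictionary] `code(I(s,t,c))` is a YES instance iff `c = ⟨t,s⟩` … -/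
theorem ipInst_mem_yes_iff : (ipInst s t c).encode ∈ SignedExactCubicSliceANF.yes ↔ c = bd t s := by
  rw [CubicANFPair.encode_mem_yes_iff]
  constructor
  · rintro ⟨-, hv⟩
    by_contra hc
    have hc' : c = !(bd t s) := by cases c <;> cases h : bd t s <;> simp_all
    rw [hc', value_ipInst_neg] at hv
    norm_num at hv
  · rintro rfl
    exact ⟨⟨k, rfl⟩, value_ipInst_pos s t⟩

/-- ★★ [dictionary] … and a NO instance iff `c = ¬⟨t,s⟩`; in particular the face is TOTAL (every `I(s,t,c)` is on the promise). -/
theorem ipInst_mem_no_iff : (ipInst s t c).encode ∈ SignedExactCubicSliceANF.no ↔ c = !(bd t s) := by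
  rw [CubicANFPair.encode_mem_no_iff]
  constructor
  · rintro ⟨-, hv⟩
    by_contra hc
    have hc' : c = bd t s := by cases c <;> cases h : bd t s <;> simp_all
    rw [hc', value_ipInst_pos] at hv
    norm_num at hv
  · rintro rfl
    exact ⟨⟨k, rfl⟩, value_ipInst_neg s t⟩

/-- ★ [dictionary: every table bit is ONE-SIDED] each bit of `I(s,t,c)` is either independent of `t`, or independent of `(s,c)`
and `0` at `t = 0` — i.e. a constant, a literal of `s`, the bit `c`, or a literal of `t`. -/
theorem ipBits_oneSided (i : AnfIdx (k + k)) :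
    (∀ (s t t' : Fin k → Bool) (c : Bool), ipBits s t c i = ipBits s t' c i) ∨
    ((∀ (s s' t : Fin k → Bool) (c c' : Bool), ipBits s t c i = ipBits s' t c' i) ∧
      ipBits (k := k) zeroVec zeroVec false i = false) := by
  rcases i with ⟨b, _ | ⟨i, j, l⟩⟩
  · cases b
    · exact Or.inl fun _ _ _ _ => rfl
    · exact Or.inl fun _ _ _ _ => rfl
  · cases b <;>
      rcases hi : finSumFinEquiv.symm i with a | a <;> rcases hl : finSumFinEquiv.symm l with a' | a'
    all_goals first
      | (left; intro s t t' c; simp [ipBits, bits, bitsFG, ipInst, ipF, ipG, blTable, MM, hi, hl]; done)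
      | (right; refine ⟨fun s s' t c c' => ?_, ?_⟩
         · simp [ipBits, bits, bitsFG, ipInst, ipF, ipG, blTable, MM, hi, hl]
         · simp [ipBits, bits, bitsFG, ipInst, ipF, ipG, blTable, MM, hi, hl, zeroVec])

/-- the `s`-side factor of a table bit's sign (at `t = 0`) -/
def uS (c : Bool) (s : Fin k → Bool) (i : AnfIdx (k + k)) : ℝ := signOf (ipBits s zeroVec c i)

/-- the `t`-side factor of a table bit's sign (at `s = 0, c = 0`, normalised by the constant part) -/
def vS (t : Fin k → Bool) (i : AnfIdx (k + k)) : ℝ :=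
  signOf (ipBits zeroVec t false i) * signOf (ipBits (k := k) zeroVec zeroVec false i)

/-- ★ [rank one] the sign of every table bit factorises: `(-1)^{bit_i(s,t,c)} = u_i(s,c) · v_i(t)`. -/
theorem signOf_ipBits (i : AnfIdx (k + k)) : signOf (ipBits s t c i) = uS c s i * vS t i := by
  rcases ipBits_oneSided (k := k) i with h | ⟨h, h0⟩
  · rw [uS, vS, h s t zeroVec c, h zeroVec t zeroVec false, Summit.QuantumAdvantage.QuantumAdvantage.Theorems.FlatDial.signOf_mul_self, mul_one]
  · rw [uS, vS, h0, h s zeroVec zeroVec c false, h0, h s zeroVec t c false]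
    simp [signOf]

/-- ★ [rank one] hence every parity character of the table factorises on the face. -/
theorem chi_ipBits (S : Finset (AnfIdx (k + k))) :
    chi S (ipBits s t c) = (∏ i ∈ S, uS c s i) * ∏ i ∈ S, vS t i := by
  rw [chi, ← prod_mul_distrib]
  exact prod_congr rfl fun i _ => signOf_ipBits s t c i

/-- ★ [rank = size] so the vote of a `THR∘XOR` circuit on the face is a bilinear form of rank `≤ size` in (functions of) `s`
and `t`: an arrangement of `size` rank-one real matrices. -/
theorem val_ipBits (D : ThrXorCkt (k + k)) :
    D.val (ipBits s t c) = ∑ i, (D.wt i * ∏ j ∈ D.gate i, uS c s j) * ∏ j ∈ D.gate i, vS t j := by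
  unfold ThrXorCkt.val
  exact sum_congr rfl fun i _ => by rw [chi_ipBits]; ring

end IPFace

/-! ## §5 W₁ DECIDED: Forster's sign-rank bound kills every polynomial-size perceptron of parities -/

/-- a margin below all positive values of a real function on a finite type -/
theorem exists_margin_aux {α : Type*} [Fintype α] (g : α → ℝ) : ∃ η : ℝ, 0 < η ∧ ∀ a, 0 < g a → η < g a := by
  classical
  by_cases hP : ((univ.image g).filter fun r => 0 < r).Nonempty
  · have hmin : 0 < ((univ.image g).filter fun r => 0 < r).min' hP :=
      (mem_filter.1 (((univ.image g).filter fun r => 0 < r).min'_mem hP)).2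
    refine ⟨((univ.image g).filter fun r => 0 < r).min' hP / 2, by linarith, fun a h => ?_⟩
    have hle : ((univ.image g).filter fun r => 0 < r).min' hP ≤ g a :=
      Finset.min'_le _ (g a) (mem_filter.2 ⟨mem_image_of_mem g (mem_univ a), h⟩)
    linarith
  · exact ⟨1, one_pos, fun a h => absurd ⟨g a, mem_filter.2 ⟨mem_image_of_mem g (mem_univ a), h⟩⟩ hP⟩

/-- a margin below all positive votes of a fixed circuit on the (finite) face -/
theorem exists_margin (D : ThrXorCkt (k + k)) :
    ∃ η : ℝ, 0 < η ∧ ∀ s t : Fin k → Bool, 0 < D.val (ipBits s t false) → η < D.val (ipBits s t false) := by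
  obtain ⟨η, hη, h⟩ :=
    exists_margin_aux fun st : (Fin k → Bool) × (Fin k → Bool) => D.val (ipBits st.1 st.2 false)
  exact ⟨η, hη, fun s t => h (s, t)⟩

/-- ★★ [the Forster edge] a perceptron-of-parities family answering the sign realises, at arity `2k`, the `±1` matrix of `IP_k`
by an arrangement of homogeneous half spaces in dimension `size + 1`. -/
theorem hasSignRepr_of_solves {C : (n : ℕ) → ThrXorCkt n} (hS : SolvesSignT C) (k : ℕ) :
    HasSignRepr (signMatrix (ipBool (m := k))) ((C (k + k)).size + 1) := by
  classical
  obtain ⟨η, hη, hmar⟩ := exists_margin (C (k + k))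
  have hpos : ∀ s t : Fin k → Bool, bd t s = false → η < (C (k + k)).val (ipBits s t false) := fun s t h =>
    hmar s t ((hS (ipInst s t false) ⟨k, rfl⟩).1 (by simpa [h] using value_ipInst_pos (k := k) s t))
  have hneg : ∀ s t : Fin k → Bool, bd t s = true → (C (k + k)).val (ipBits s t false) ≤ 0 := fun s t h =>
    not_lt.1 ((hS (ipInst s t false) ⟨k, rfl⟩).2 (by simpa [h] using value_ipInst_neg (k := k) s t))
  have h := HasSignRepr.of_fintype (M := signMatrix (ipBool (m := k))) (ι := Option (Fin (C (k + k)).size))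
    (fun s o => o.elim η fun i => -((C (k + k)).wt i * ∏ j ∈ (C (k + k)).gate i, uS false s j))
    (fun t o => o.elim 1 fun i => ∏ j ∈ (C (k + k)).gate i, vS t j) (fun s t => by
      have e : ∑ o : Option (Fin (C (k + k)).size),
          (Option.elim o η fun i => -((C (k + k)).wt i * ∏ j ∈ (C (k + k)).gate i, uS false s j)) *
            (Option.elim o 1 fun i => ∏ j ∈ (C (k + k)).gate i, vS t j)
          = η - (C (k + k)).val (ipBits s t false) := by
        rw [Fintype.sum_option, val_ipBits]
        simp only [Option.elim, mul_one, neg_mul, sum_neg_distrib]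
        ring
      rw [e, signMatrix, ← bd_eq_ipBool]
      cases hb : bd t s
      · have := hpos s t hb
        simp only [Bool.false_eq_true, if_false]
        linarith
      · have := hneg s t hb
        simp only [if_true]
        linarith)
  simpa [Fintype.card_option, Fintype.card_fin] using h

/-- ★★★ [W₁ DECIDED] `ThrRungNU`: NO polynomial-size perceptron of parities — arbitrary real weights — answers the sign of exact
cubic Forrelation.  (Forster: `signrk(IP_k)² ≥ 2^k`; the IP face turns a size-`r` circuit at arity `2k` into a realisation of
`IP_k` in dimension `r + 1 ≤ p(2k) + 1`, and `(p(2k)+1)² < 2^k` for large `k`.) -/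
theorem thrRungNU : ThrRungNU := by
  rw [thrRungNU_iff]
  rintro C ⟨p, hp⟩ hS
  obtain ⟨k, -, hk⟩ := BGS.exists_lt_two_pow ((p.comp (2 * Polynomial.X) + 1) ^ 2) 0
  have hF := Forster2002_cor22_signRepr (hasSignRepr_of_solves hS k)
  have hq : ((p.comp (2 * Polynomial.X) + 1) ^ 2).eval k = (p.eval (2 * k) + 1) ^ 2 := by
    simp [Polynomial.eval_comp]
  rw [hq] at hk
  rw [two_mul] at hk
  have hsz : (C (k + k)).size + 1 ≤ p.eval (k + k) + 1 := by
    have := hp (k + k); omega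
  have h1 : (((C (k + k)).size + 1 : ℕ) : ℝ) ^ 2 ≤ ((p.eval (k + k) + 1 : ℕ) : ℝ) ^ 2 := by
    gcongr
  have h2 : ((p.eval (k + k) + 1 : ℕ) : ℝ) ^ 2 < (2 : ℝ) ^ k := by exact_mod_cast hk
  have h3 : (2 : ℝ) ^ k ≤ (((C (k + k)).size + 1 : ℕ) : ℝ) ^ 2 := by exact_mod_cast hF
  linarith

/-! ## §6 Laws: necessity, comparison, the split, the root -/

/-- [law] the non-uniform rung implies the uniform one -/
theorem thrRung_of_thrRungNU : ThrRungNU → ThrRung := fun h hm => h (promiseLift_mono Set.inter_subset_left hm)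

/-- ★★★ [W₁ᵘ DECIDED] -/
theorem thrRung : ThrRung := thrRung_of_thrRungNU thrRungNU

/-- [law · necessity] `X → ThrRung` (`promiseLift (ThrXor ∩ P) ⊆ PromiseP ⊆ PromiseBPP'`). -/
theorem thrRung_of_anfResidual : AnfResidual → ThrRung :=
  fun hres h => hres (PromiseP_subset_PromiseBPP' (promiseLift_mono Set.inter_subset_right h))

/-- [law · necessity] `X → VoteRung2`. -/
theorem voteRung2_of_anfResidual : AnfResidual → VoteRung2 :=
  fun hres h => hres (PromiseP_subset_PromiseBPP' (promiseLift_mono Set.inter_subset_right h))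

/-- [law] `VoteRung2NU → VoteRung2`. -/
theorem voteRung2_of_voteRung2NU : VoteRung2NU → VoteRung2 := fun h hm => h (promiseLift_mono Set.inter_subset_left hm)

/-- [law · necessity] `LiftA → PercLift` and `X → PercLift`. -/
theorem percLift_of_liftA : LiftA → PercLift := fun ℓ r _ => ℓ r

/-- PerceptronDialLawsB helper `percLift_of_anfResidual` (decomp-qadv land package; see the module docstring). -/
theorem percLift_of_anfResidual : AnfResidual → PercLift := fun x _ _ => x

/-- [law · sufficiency] the open pieces give back the parent residual. -/
theorem liftA_of_voteRung2_percLift : VoteRung2 → PercLift → LiftA := fun v ℓ r => ℓ r v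

/-- ★ [split of the parent residual] `LiftA ↔ (RungA → VoteRung2) ∧ PercLift`. -/
theorem liftA_iff : LiftA ↔ (RungA → VoteRung2) ∧ PercLift :=
  ⟨fun ℓ => ⟨fun r => voteRung2_of_anfResidual (ℓ r), percLift_of_liftA ℓ⟩, fun h r => h.2 r (h.1 r)⟩

/-- ★★ [exact split of the target] `X ↔ RungA ∧ ThrRung ∧ VoteRung2 ∧ PercLift` — every piece NECESSARY, jointly SUFFICIENT;
`ThrRung` is a THEOREM (`thrRung`), so the open content of `X` is `RungA ∧ VoteRung2 ∧ PercLift`. -/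
theorem anfResidual_iff : AnfResidual ↔ RungA ∧ ThrRung ∧ VoteRung2 ∧ PercLift :=
  ⟨fun x => ⟨rungA_of_anfResidual x, thrRung_of_anfResidual x, voteRung2_of_anfResidual x, percLift_of_anfResidual x⟩,
    fun h => h.2.2.2 h.1 h.2.2.1⟩

/-- PerceptronDialLawsB helper `anfResidual_iff_open` (decomp-qadv land package; see the module docstring). -/
theorem anfResidual_iff_open : AnfResidual ↔ RungA ∧ VoteRung2 ∧ PercLift :=
  ⟨fun x => ⟨rungA_of_anfResidual x, voteRung2_of_anfResidual x, percLift_of_anfResidual x⟩, fun h => h.2.2 h.1 h.2.1⟩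

/-! ## §7 The certified attack edge beneath W₂: sampled faces and the discriminator lemma

A `MAJ∘XOR∘AND₂` circuit that answers the sign on a sampled face of the slice has, by the discriminator lemma
(Hajnal–Maass–Pudlák–Szegedy–Turán 1993, [Jukna 2012, Lemma 11.36]), ONE quadratic phase gate whose correlation with the
sign over the face is at least `1/size`.  Hence a face on which EVERY quadratic phase of the table bits has correlation
`< 1/(2·p(n))` with the sign defeats every quadratic-vote family of size `≤ p(n)`: `voteRung2NU_of_face`.  (The IP face of §4
is NOT such a face — its sign `⟨t,s⟩` IS a quadratic phase of its table bits; the candidate is the QUADRATIC-KEY face of §8.) -/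

/-- ★ a SAMPLED FACE of the exact slice: at scale `m`, parameters `w : Ω m` (a finite nonempty type, sampled uniformly) ↦ an
instance `(F_w, G_w)` of (even) arity `arity m` whose Forrelation value is `(-1)^{sgn w}`, with at least half of the parameters on
the YES side. -/
structure QFace (Ω : ℕ → Type) [∀ m, Fintype (Ω m)] where
  /-- arity of the sampled instances at scale `m` -/
  arity : ℕ → ℕ
  /-- the sampled forms -/
  formF : (m : ℕ) → Ω m → CubicForm (arity m)
  formG : (m : ℕ) → Ω m → CubicForm (arity m)
  /-- the sign: `false` = YES (value `1`), `true` = NO (value `-1`) -/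
  sgn : (m : ℕ) → Ω m → Bool
  nonempty : ∀ m, Nonempty (Ω m)
  even : ∀ m, Even (arity m)
  value_eq : ∀ m w, (⟨arity m, formF m w, formG m w⟩ : CubicANFPair).value = signOf (sgn m w)
  balanced : ∀ m, Fintype.card (Ω m) ≤ 2 * (univ.filter fun w => sgn m w = false).card

namespace QFace

variable {Ω : ℕ → Type} [∀ m, Fintype (Ω m)] (Φ : QFace Ω)

/-- the sampled instance -/
def inst (m : ℕ) (w : Ω m) : CubicANFPair := ⟨Φ.arity m, Φ.formF m w, Φ.formG m w⟩

/-- its table bits -/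
def tbits (m : ℕ) (w : Ω m) : AnfIdx (Φ.arity m) → Bool := bits (Φ.inst m w)

/-- the (unnormalised) correlation of ONE quadratic phase gate with the sign over the face at scale `m` -/
def corr (m : ℕ) (c : Bool) (S : Finset (AnfIdx (Φ.arity m) × AnfIdx (Φ.arity m))) : ℝ :=
  ∑ w, signOf (Φ.sgn m w) * signOf (qphase c S (Φ.tbits m w))

/-- ★★ QUADRATIC-VOTE HARDNESS of a face: for every polynomial `p`, at some scale EVERY quadratic phase of the table bits has
correlation `< 1/(2 p(n))` with the sign (`n` = arity). -/
def QuadUncorrelated : Prop :=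
  ∀ p : Polynomial ℕ, ∃ m, ∀ (c : Bool) (S : Finset (AnfIdx (Φ.arity m) × AnfIdx (Φ.arity m))),
    2 * ((p.eval (Φ.arity m) : ℕ) : ℝ) * |Φ.corr m c S| < Fintype.card (Ω m)

end QFace

/-- the vote is an integer -/
theorem MajQuadCkt.val_eq_intCast (D : MajQuadCkt n) (x : AnfIdx n → Bool) :
    D.val x = ((∑ i, (if qphase (D.cst i) (D.mono i) x = true then (-1 : ℤ) else 1) : ℤ) : ℝ) := by
  unfold MajQuadCkt.val
  push_cast
  exact sum_congr rfl fun i _ => by unfold signOf; split_ifs <;> simp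

/-- a positive vote is at least `1` -/
theorem MajQuadCkt.one_le_val_of_pos (D : MajQuadCkt n) (x : AnfIdx n → Bool) (h : 0 < D.val x) : 1 ≤ D.val x := by
  rw [D.val_eq_intCast] at h ⊢
  have h' : (0 : ℤ) < ∑ i, (if qphase (D.cst i) (D.mono i) x = true then (-1 : ℤ) else 1) := by exact_mod_cast h
  have h'' := Int.lt_iff_add_one_le.mp h'
  rw [zero_add] at h''
  exact_mod_cast h''


end Summit.QuantumAdvantage.QuantumAdvantage.Theorems.PerceptronDial
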